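import Summits.AtomisticToContinuum.FouriersLaw.Theorems.EmbeddedDrudeMourreAbelThermodynamicLimitAnchoredKuboPairCorrelations
import Summits.AtomisticToContinuum.FouriersLaw.Theorems.BondHeatUncertaintyLightConeBondHeatBondCorrelation
import Summits.AtomisticToContinuum.FouriersLaw.Theorems.EmbeddedDrudeMourreAbelThermodynamicLimitWitnessPositiveType
import HarnessLib

/-!
# `stub_fixedHorizonMatching` of line `loomis-compact-horizon-witness`, part 1: reduction to fixed times
(crux `EmbeddedDrudeMourre.AbelThermodynamicLimit`, item stmt-AtomisticToContinuum-12596;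
`--supports` helper file for the registered stub S4 `stub_fixedHorizonMatching`, closes nothing)

The registered stub S4: for `P = pinnedChain ω₂ lam β γ` (all `> 0`), `T > 0` at which the DLR states of
the regular class are unique, every regular witness `(μT, D)` and every FIXED horizon `τ > 0`,
`W_N(τ) = Σ_k ∫_{(0,τ]} (1 - t/τ)² ⟨j_{c_N}(0) j_k(t)⟩_{N,T} dt → ∫_{(0,τ]} (1 - t/τ)² C_T(t) dt`, where
`⟨j_i(0) j_k(t)⟩_{N,T} = ∫ j_i · P_t j_k dμ_{N,T}` is the equilibrium pair correlation of bond currents of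
the OPEN `N`-chain (Gibbs measure `gibbsMeasure N T`, constructed kernels `transitionKernel N T T t`),
`c_N = ⌊(N-1)/2⌋` the central bond, `C_T = D.currentCorrelation μT`. This file (sorry-free):

* §1 fixed `N ≥ 1`: `t ↦ ⟨j_i(0) j_k(t)⟩_{N,T}` is measurable, `|⟨j_i(0) j_k(t)⟩_{N,T}| ≤ ½(⟨j_i²⟩_T + ⟨j_k²⟩_T)`
  (AM–GM + `L²(μ_T)`-contraction of the kernels), so the stub's pair integrals are honest and
  `W_N(τ) = ∫_{(0,τ]} (1 - t/τ)² S_N(t) dt`, `S_N(t) = Σ_k ⟨j_{c_N}(0) j_k(t)⟩_{N,T}` the ANCHORED SUM;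
* §2 **registered sub-goal `stub_fixedHorizonMatchingOfFixedTime`**: S4's hypotheses + (L1) FIXED-TIME
  MATCHING `S_N(t) → C_T(t)` (`t > 0`) + (L2) `N`-UNIFORM LOCAL BOUNDEDNESS of `S_N` on every `[0, τ]`
  ⟹ S4's conclusion (dominated convergence on `(0, τ]`; `C_T` measurable and bounded by the landed S2).
  (L1)–(L2) are the fixed-time light-cone / ensemble-equivalence content of S4 (Disproof §4 (2));
* §3 bookkeeping for the window `|k - c_N| ≤ R` (reindexing by offsets, window/tail split, tail
  monotonicity, `≤ 2R + 1` bonds), used by part 2 (`…FixedHorizonMatchingWindowLeaves`), which splits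
  (L1), (L2) into per-offset matching, `N`-uniform anchored tails and central second moments.
-/

noncomputable section

open MeasureTheory ProbabilityTheory Filter Topology Set Function
open scoped NNReal ENNReal

namespace Summit.AtomisticToContinuum.FouriersLaw.Theorems.AbelThermodynamicLimit.LoomisCompactHorizonWitness

open Literature.MathematicalPhysics.KineticTheory.HeatConduction
open Literature.MathematicalPhysics.KineticTheory OscillatorChain
open Summit.AtomisticToContinuum.FouriersLaw.Theorems.SubdiffusiveBondHeat
open Summit.AtomisticToContinuum.FouriersLaw.Theorems.LightConeBondHeat
open Summit.AtomisticToContinuum.FouriersLaw.Theorems.OddSectorIrreversibility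
open Summit.AtomisticToContinuum.FouriersLaw.Theorems.OddSectorIrreversibility.Corrector

variable {N : ℕ}

/-! ## §1 Fixed-`N` facts on the equilibrium pair correlations of bond currents -/

/-- On `(0, τ]` the Riesz weight satisfies `|(1 - t/τ)²| ≤ 1`. [folklore] -/
theorem abs_rieszWeight_le_one {τ t : ℝ} (hτ : 0 < τ) (ht : t ∈ Ioc (0 : ℝ) τ) : |(1 - t / τ) ^ 2| ≤ 1 := by
  rw [abs_pow, abs_of_nonneg]
  · have h1 : 0 ≤ t / τ := div_nonneg ht.1.le hτ.le
    have h2 : 1 - t / τ ≤ 1 := by linarith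
    calc (1 - t / τ) ^ 2 ≤ 1 ^ 2 := by
          apply pow_le_pow_left₀ _ h2
          rw [sub_nonneg, div_le_one hτ]; exact ht.2
      _ = 1 := one_pow 2
  · rw [sub_nonneg, div_le_one hτ]; exact ht.2

section FixedN

variable {ω₂ lam β γ : ℝ} (hω : 0 < ω₂) (hl : 0 ≤ lam) (hβ : 0 < β) (hγ : 0 < γ) (hN : 0 < N)
  {T : ℝ} (hT : 0 < T)
include hω hl hβ hγ hN hT

omit hN in
/-- `t ↦ ⟨j_i(0) j_k(t)⟩_{N,T} = ∫ j_i · P_{t⁺} j_k dμ_T` is measurable (joint measurability of the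
constructed kernels in `(t, z)`). [folklore] -/
theorem pinnedChain_measurable_pairCorr (i k : Fin N) :
    Measurable fun t : ℝ => ∫ z, (pinnedChain ω₂ lam β γ).bondCurrent N i z *
        (∫ y, (pinnedChain ω₂ lam β γ).bondCurrent N k y
          ∂((pinnedChain ω₂ lam β γ).transitionKernel N T T t.toNNReal z))
      ∂((pinnedChain ω₂ lam β γ).gibbsMeasure N T) :=
  pinnedChain_measurable_crossCorr hω hl hT (pinnedChain_continuous_bondCurrent ω₂ lam β γ N i)
    (pinnedChain_continuous_bondCurrent ω₂ lam β γ N k) hβ.le hγ.le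

/-- **`|⟨j_i(0) j_k(t)⟩_{N,T}| ≤ ½(⟨j_i²⟩_T + ⟨j_k²⟩_T)`**: weighted AM–GM under the integral and the
`L²(μ_T)`-contraction `∫ (P_t j_k)² dμ_T ≤ ∫ j_k² dμ_T` of the Markov kernels leaving `μ_T` invariant.
The bound does not depend on `t`. [folklore] -/
theorem pinnedChain_abs_pairCorr_le (i k : Fin N) (t : ℝ) :
    |∫ z, (pinnedChain ω₂ lam β γ).bondCurrent N i z *
        (∫ y, (pinnedChain ω₂ lam β γ).bondCurrent N k y
          ∂((pinnedChain ω₂ lam β γ).transitionKernel N T T t.toNNReal z))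
      ∂((pinnedChain ω₂ lam β γ).gibbsMeasure N T)| ≤
      ((∫ z, (pinnedChain ω₂ lam β γ).bondCurrent N i z ^ 2 ∂((pinnedChain ω₂ lam β γ).gibbsMeasure N T)) +
        ∫ z, (pinnedChain ω₂ lam β γ).bondCurrent N k z ^ 2 ∂((pinnedChain ω₂ lam β γ).gibbsMeasure N T)) / 2 := by
  obtain ⟨hϑ0, h2ϑ⟩ := quarter_inv_temp_admissible hT
  have hfi := pinnedChain_continuous_bondCurrent ω₂ lam β γ N i
  have hfk := pinnedChain_continuous_bondCurrent ω₂ lam β γ N k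
  have hbi := pinnedChain_abs_bondCurrent_le_exp hω.le hl hβ.le γ N hϑ0 i
  have hbk := pinnedChain_abs_bondCurrent_le_exp hω.le hl hβ.le γ N hϑ0 k
  obtain ⟨hi2, -, -⟩ := pinnedChain_integral_sq_act_le hω hl hβ hγ hN hT hϑ0 h2ϑ hfi hbi t.toNNReal
  obtain ⟨-, hPk2, hle⟩ := pinnedChain_integral_sq_act_le hω hl hβ hγ hN hT hϑ0 h2ϑ hfk hbk t.toNNReal
  have hprod := pinnedChain_integrable_mul_act hω hl hβ hγ hN hT hϑ0 h2ϑ hfi hbi hfk hbk t.toNNReal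
  clear hbi hbk hfi hfk
  set P := pinnedChain ω₂ lam β γ with hP
  set μ := P.gibbsMeasure N T with hμ
  have hpt : ∀ z, |P.bondCurrent N i z * (∫ y, P.bondCurrent N k y ∂(P.transitionKernel N T T t.toNNReal z))|
      ≤ (P.bondCurrent N i z ^ 2 +
          (∫ y, P.bondCurrent N k y ∂(P.transitionKernel N T T t.toNNReal z)) ^ 2) / 2 := by
    intro z
    set a : ℝ := P.bondCurrent N i z
    set b : ℝ := ∫ y, P.bondCurrent N k y ∂(P.transitionKernel N T T t.toNNReal z)
    rw [abs_mul]
    nlinarith [sq_nonneg (|a| - |b|), sq_abs a, sq_abs b, abs_nonneg a, abs_nonneg b]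
  have h1 : |∫ z, P.bondCurrent N i z * (∫ y, P.bondCurrent N k y ∂(P.transitionKernel N T T t.toNNReal z)) ∂μ|
      ≤ ∫ z, |P.bondCurrent N i z * (∫ y, P.bondCurrent N k y ∂(P.transitionKernel N T T t.toNNReal z))| ∂μ :=
    abs_integral_le_integral_abs
  have h2 : ∫ z, |P.bondCurrent N i z * (∫ y, P.bondCurrent N k y ∂(P.transitionKernel N T T t.toNNReal z))| ∂μ
      ≤ ∫ z, (P.bondCurrent N i z ^ 2 +
          (∫ y, P.bondCurrent N k y ∂(P.transitionKernel N T T t.toNNReal z)) ^ 2) / 2 ∂μ :=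
    integral_mono hprod.abs ((hi2.add hPk2).div_const 2) hpt
  have h3 : ∫ z, (P.bondCurrent N i z ^ 2 +
          (∫ y, P.bondCurrent N k y ∂(P.transitionKernel N T T t.toNNReal z)) ^ 2) / 2 ∂μ =
      ((∫ z, P.bondCurrent N i z ^ 2 ∂μ) +
        ∫ z, (∫ y, P.bondCurrent N k y ∂(P.transitionKernel N T T t.toNNReal z)) ^ 2 ∂μ) / 2 := by
    rw [integral_div, integral_add hi2 hPk2]
  linarith

/-- `t ↦ (1 - t/τ)² ⟨j_i(0) j_k(t)⟩_{N,T}` is integrable on `(0, τ]` (bounded and measurable on a set of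
finite measure): the pair integrals of the stub are honest Bochner integrals. [folklore] -/
theorem pinnedChain_integrableOn_rieszWeight_mul_pairCorr (i k : Fin N) {τ : ℝ} (hτ : 0 < τ) :
    IntegrableOn (fun t : ℝ => (1 - t / τ) ^ 2 *
      ∫ z, (pinnedChain ω₂ lam β γ).bondCurrent N i z *
        (∫ y, (pinnedChain ω₂ lam β γ).bondCurrent N k y
          ∂((pinnedChain ω₂ lam β γ).transitionKernel N T T t.toNNReal z))
      ∂((pinnedChain ω₂ lam β γ).gibbsMeasure N T)) (Ioc 0 τ) := by
  set P := pinnedChain ω₂ lam β γ with hP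
  set μ := P.gibbsMeasure N T with hμ
  set B : ℝ := ((∫ z, P.bondCurrent N i z ^ 2 ∂μ) + ∫ z, P.bondCurrent N k z ^ 2 ∂μ) / 2 with hB
  have hmeas : Measurable fun t : ℝ => (1 - t / τ) ^ 2 *
      ∫ z, P.bondCurrent N i z * (∫ y, P.bondCurrent N k y ∂(P.transitionKernel N T T t.toNNReal z)) ∂μ :=
    (by fun_prop : Measurable fun t : ℝ => (1 - t / τ) ^ 2).mul
      (pinnedChain_measurable_pairCorr hω hl hβ hγ hT i k)
  refine Measure.integrableOn_of_bounded (M := B) measure_Ioc_lt_top.ne hmeas.aestronglyMeasurable ?_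
  refine (ae_restrict_iff' measurableSet_Ioc).2 (ae_of_all _ fun t ht => ?_)
  rw [norm_mul, Real.norm_eq_abs, Real.norm_eq_abs]
  calc |(1 - t / τ) ^ 2| * |∫ z, P.bondCurrent N i z *
          (∫ y, P.bondCurrent N k y ∂(P.transitionKernel N T T t.toNNReal z)) ∂μ|
      ≤ 1 * B := mul_le_mul (abs_rieszWeight_le_one hτ ht)
          (pinnedChain_abs_pairCorr_le hω hl hβ hγ hN hT i k t) (abs_nonneg _) zero_le_one
    _ = B := one_mul B

/-- **`W_N(τ) = ∫_{(0,τ]} (1 - t/τ)² S_N(t) dt`**: the bond sum and the time integral of the stub commute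
(each pair integrand is integrable on `(0, τ]`), `S_N(t) = Σ_k ⟨j_i(0) j_k(t)⟩_{N,T}`. [folklore] -/
theorem pinnedChain_sum_integral_rieszWeight_mul_pairCorr (i : Fin N) {τ : ℝ} (hτ : 0 < τ) :
    (∑ k : Fin N, ∫ t in Ioc (0 : ℝ) τ, (1 - t / τ) ^ 2 *
      ∫ z, (pinnedChain ω₂ lam β γ).bondCurrent N i z *
        (∫ y, (pinnedChain ω₂ lam β γ).bondCurrent N k y
          ∂((pinnedChain ω₂ lam β γ).transitionKernel N T T t.toNNReal z))
      ∂((pinnedChain ω₂ lam β γ).gibbsMeasure N T)) =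
    ∫ t in Ioc (0 : ℝ) τ, (1 - t / τ) ^ 2 * ∑ k : Fin N,
      ∫ z, (pinnedChain ω₂ lam β γ).bondCurrent N i z *
        (∫ y, (pinnedChain ω₂ lam β γ).bondCurrent N k y
          ∂((pinnedChain ω₂ lam β γ).transitionKernel N T T t.toNNReal z))
      ∂((pinnedChain ω₂ lam β γ).gibbsMeasure N T) := by
  rw [← integral_finsetSum _ fun k _ =>
    pinnedChain_integrableOn_rieszWeight_mul_pairCorr hω hl hβ hγ hN hT i k hτ]
  refine integral_congr_ae (ae_of_all _ fun t => ?_)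
  simp only [Finset.mul_sum]

end FixedN

/-! ## §2 S4 from fixed-time matching and `N`-uniform local boundedness -/

/-- **Registered sub-goal `stub_fixedHorizonMatchingOfFixedTime` — S4 reduced to fixed times.** The
hypotheses of the registered stub S4 `stub_fixedHorizonMatching`, plus, for the anchored sum
`S_N(t) = Σ_k ⟨j_{c_N}(0) j_k(t)⟩_{N,T}` of equilibrium pair correlations of the open `N`-chain:
(L2) `N`-UNIFORM LOCAL BOUNDEDNESS — for every `τ > 0` there are `M`, `N₀` with `|S_N(t)| ≤ M` for all
`N ≥ N₀` (`N ≥ 2`) and `t ∈ [0, τ]`; and (L1) FIXED-TIME MATCHING — `S_N(t) → C_T(t)` for every `t > 0`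
(`C_T = D.currentCorrelation μT`); imply S4's conclusion
`W_N(τ) = Σ_k ∫_{(0,τ]} (1 - t/τ)² ⟨j_{c_N}(0) j_k(t)⟩_{N,T} dt → ∫_{(0,τ]} (1 - t/τ)² C_T(t) dt` for every
`τ > 0`. Proof: `W_N(τ) = ∫_{(0,τ]} (1 - t/τ)² S_N(t) dt` (§1) and dominated convergence on `(0, τ]`
with the constant bound `M` (`C_T` measurable and bounded: S2, landed). (L1)–(L2) are the fixed-time
light-cone / ensemble-equivalence content of S4 (Disproof §4 step (2)). [folklore] -/
theorem stub_fixedHorizonMatchingOfFixedTime :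
    ∀ ω₂ lam β γ : ℝ, 0 < ω₂ → 0 < lam → 0 < β → 0 < γ → ∀ T : ℝ, 0 < T →
      (∀ μ₁ μ₂ : MeasureTheory.Measure
            Literature.MathematicalPhysics.KineticTheory.HeatConduction.ChainConfig,
          (Literature.MathematicalPhysics.KineticTheory.HeatConduction.pinnedChain
                ω₂ lam β γ).IsChainGibbsMeasure T μ₁ →
          Literature.MathematicalPhysics.KineticTheory.HeatConduction.IsShiftInvariant μ₁ →
          (Literature.MathematicalPhysics.KineticTheory.HeatConduction.pinnedChain
                ω₂ lam β γ).HasSuperstabilityEstimate μ₁ →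
          (Literature.MathematicalPhysics.KineticTheory.HeatConduction.pinnedChain
                ω₂ lam β γ).IsChainGibbsMeasure T μ₂ →
          Literature.MathematicalPhysics.KineticTheory.HeatConduction.IsShiftInvariant μ₂ →
          (Literature.MathematicalPhysics.KineticTheory.HeatConduction.pinnedChain
                ω₂ lam β γ).HasSuperstabilityEstimate μ₂ → μ₁ = μ₂) →
      ∀ (μT : MeasureTheory.Measure
            Literature.MathematicalPhysics.KineticTheory.HeatConduction.ChainConfig)
        (D : Literature.MathematicalPhysics.KineticTheory.HeatConduction.InfiniteChainDynamics
          (Literature.MathematicalPhysics.KineticTheory.HeatConduction.pinnedChain ω₂ lam β γ)),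
        (Literature.MathematicalPhysics.KineticTheory.HeatConduction.pinnedChain
            ω₂ lam β γ).IsChainGibbsMeasure T μT →
        Literature.MathematicalPhysics.KineticTheory.HeatConduction.IsShiftInvariant μT →
        (Literature.MathematicalPhysics.KineticTheory.HeatConduction.pinnedChain
            ω₂ lam β γ).HasSuperstabilityEstimate μT →
        D.carrier ⊆ (Literature.MathematicalPhysics.KineticTheory.HeatConduction.pinnedChain
            ω₂ lam β γ).bmGood →
        D.PreservesMeasure μT →
        (∀ t : ℝ, D.HasAbsConvergentCorrelation μT t) →
        (∀ τ : ℝ, 0 < τ → ∃ M : ℝ, ∃ N₀ : ℕ, ∀ N : ℕ, N₀ ≤ N → ∀ hN : 2 ≤ N,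
          ∀ t ∈ Set.Icc (0 : ℝ) τ,
            |∑ k : Fin N,
              ∫ z, (Literature.MathematicalPhysics.KineticTheory.HeatConduction.pinnedChain
                      ω₂ lam β γ).bondCurrent N ⟨(N - 1) / 2, by omega⟩ z *
                (∫ y, (Literature.MathematicalPhysics.KineticTheory.HeatConduction.pinnedChain
                      ω₂ lam β γ).bondCurrent N k y
                  ∂((Literature.MathematicalPhysics.KineticTheory.HeatConduction.pinnedChain
                      ω₂ lam β γ).transitionKernel N T T t.toNNReal z))
              ∂((Literature.MathematicalPhysics.KineticTheory.HeatConduction.pinnedChain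
                      ω₂ lam β γ).gibbsMeasure N T)| ≤ M) →
        (∀ t : ℝ, 0 < t →
          Filter.Tendsto (fun N : ℕ =>
              if hN : 2 ≤ N then
                ∑ k : Fin N,
                  ∫ z, (Literature.MathematicalPhysics.KineticTheory.HeatConduction.pinnedChain
                          ω₂ lam β γ).bondCurrent N ⟨(N - 1) / 2, by omega⟩ z *
                    (∫ y, (Literature.MathematicalPhysics.KineticTheory.HeatConduction.pinnedChain
                          ω₂ lam β γ).bondCurrent N k y
                      ∂((Literature.MathematicalPhysics.KineticTheory.HeatConduction.pinnedChain
                          ω₂ lam β γ).transitionKernel N T T t.toNNReal z))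
                  ∂((Literature.MathematicalPhysics.KineticTheory.HeatConduction.pinnedChain
                          ω₂ lam β γ).gibbsMeasure N T)
              else 0)
            Filter.atTop (nhds (D.currentCorrelation μT t))) →
        ∀ τ : ℝ, 0 < τ →
          Filter.Tendsto (fun N : ℕ =>
              if hN : 2 ≤ N then
                ∑ k : Fin N, ∫ t in Set.Ioc (0 : ℝ) τ, (1 - t / τ) ^ 2 *
                  ∫ z, (Literature.MathematicalPhysics.KineticTheory.HeatConduction.pinnedChain
                          ω₂ lam β γ).bondCurrent N ⟨(N - 1) / 2, by omega⟩ z *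
                    (∫ y, (Literature.MathematicalPhysics.KineticTheory.HeatConduction.pinnedChain
                          ω₂ lam β γ).bondCurrent N k y
                      ∂((Literature.MathematicalPhysics.KineticTheory.HeatConduction.pinnedChain
                          ω₂ lam β γ).transitionKernel N T T t.toNNReal z))
                  ∂((Literature.MathematicalPhysics.KineticTheory.HeatConduction.pinnedChain
                          ω₂ lam β γ).gibbsMeasure N T)
              else 0)
            Filter.atTop
            (nhds (∫ t in Set.Ioc (0 : ℝ) τ, (1 - t / τ) ^ 2 * D.currentCorrelation μT t)) := by
  intro ω₂ lam β γ hω hl hβ hγ T hT _hU μT D hG hS hss hcar hPres hAC hBnd hPt τ hτ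
  -- the witness side: `C_T` measurable and bounded (S2, landed)
  obtain ⟨hCm, ⟨MC, hMC⟩, -⟩ :=
    stub_witnessPositiveType ω₂ lam β γ hω hl hβ hγ T hT μT D hG hS hss hcar hPres hAC
  obtain ⟨M, N₀, hM⟩ := hBnd τ hτ
  have hM0 : 0 ≤ M := by
    have h := hM (max N₀ 2) (le_max_left _ _) (le_max_right _ _) 0 ⟨le_rfl, hτ.le⟩
    exact (abs_nonneg _).trans h
  -- the anchored sum behind the `dite`, as a function of `(N, t)`
  set S : ℕ → ℝ → ℝ := fun N t =>
    if hN : 2 ≤ N then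
      ∑ k : Fin N, ∫ z, (pinnedChain ω₂ lam β γ).bondCurrent N ⟨(N - 1) / 2, by omega⟩ z *
        (∫ y, (pinnedChain ω₂ lam β γ).bondCurrent N k y
          ∂((pinnedChain ω₂ lam β γ).transitionKernel N T T t.toNNReal z))
        ∂((pinnedChain ω₂ lam β γ).gibbsMeasure N T)
    else 0 with hSdef
  have hSm : ∀ N, Measurable (S N) := by
    intro N
    by_cases hN : 2 ≤ N
    · simp only [hSdef, dif_pos hN]
      exact Finset.measurable_sum _ fun k _ =>
        pinnedChain_measurable_pairCorr hω hl.le hβ hγ hT _ k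
    · simp only [hSdef, dif_neg hN]
      exact measurable_const
  -- dominated convergence on `(0, τ]`
  have key : Tendsto (fun N => ∫ t in Ioc (0 : ℝ) τ, (1 - t / τ) ^ 2 * S N t) atTop
      (𝓝 (∫ t in Ioc (0 : ℝ) τ, (1 - t / τ) ^ 2 * D.currentCorrelation μT t)) := by
    refine tendsto_integral_filter_of_dominated_convergence (fun _ => M) ?_ ?_ ?_ ?_
    · exact Eventually.of_forall fun N =>
        ((by fun_prop : Measurable fun t : ℝ => (1 - t / τ) ^ 2).mul (hSm N)).aestronglyMeasurable
    · filter_upwards [eventually_ge_atTop N₀] with N hN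
      refine (ae_restrict_iff' measurableSet_Ioc).2 (ae_of_all _ fun t ht => ?_)
      rw [norm_mul, Real.norm_eq_abs, Real.norm_eq_abs]
      by_cases h2 : 2 ≤ N
      · have hb := hM N hN h2 t ⟨ht.1.le, ht.2⟩
        simp only [hSdef, dif_pos h2]
        calc _ ≤ 1 * M := mul_le_mul (abs_rieszWeight_le_one hτ ht) hb (abs_nonneg _) zero_le_one
          _ = M := one_mul M
      · simp only [hSdef, dif_neg h2, abs_zero, mul_zero]
        exact hM0
    · exact integrable_const M
    · refine (ae_restrict_iff' measurableSet_Ioc).2 (ae_of_all _ fun t ht => ?_)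
      exact (hPt t ht.1).const_mul ((1 - t / τ) ^ 2)
  -- the stub's sequence is eventually `∫_{(0,τ]} (1 - t/τ)² S_N`
  refine key.congr' ?_
  filter_upwards [eventually_ge_atTop 2] with N hN
  have hN0 : 0 < N := by omega
  rw [dif_pos hN]
  rw [pinnedChain_sum_integral_rieszWeight_mul_pairCorr hω hl.le hβ hγ hN0 hT _ hτ]
  refine integral_congr_ae (ae_of_all _ fun t => ?_)
  simp only [hSdef, dif_pos hN]

/-! ## §3 Window bookkeeping around the central bond `c_N = ⌊(N-1)/2⌋`

The window of radius `R` is `{k : c_N - R ≤ k ≤ c_N + R}`, written subtraction-free as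
`(N-1)/2 ≤ k + R ∧ k ≤ (N-1)/2 + R`; for `N ≥ 2R + 2` it consists of the genuine bonds `c_N + x`,
`x ∈ [-R, R]`. -/

section Window

/-- **Reindexing the window by offsets.** For `N ≥ 2R + 2` the window sum over `k` is the sum over
the offsets `x ∈ [-R, R]` of the terms at the bonds `c_N + x` (each offset guard `2|x| + 2 ≤ N`
holds). [folklore] -/
theorem sum_ite_window_eq_sum_Icc {N R : ℕ} (hN : 2 * R + 2 ≤ N) (f : Fin N → ℝ) :
    (∑ k : Fin N, if (N - 1) / 2 ≤ k.val + R ∧ k.val ≤ (N - 1) / 2 + R then f k else 0) =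
      ∑ x ∈ Finset.Icc (-(R : ℤ)) R,
        if hx : 2 * x.natAbs + 2 ≤ N then f ⟨((((N - 1) / 2 : ℕ) : ℤ) + x).toNat, by omega⟩ else 0 := by
  classical
  rw [← Finset.sum_filter]
  refine Finset.sum_nbij' (fun k : Fin N => ((k.val : ℤ) - (((N - 1) / 2 : ℕ) : ℤ)))
    (fun x : ℤ => if h : ((((N - 1) / 2 : ℕ) : ℤ) + x).toNat < N then
      ⟨((((N - 1) / 2 : ℕ) : ℤ) + x).toNat, h⟩ else ⟨0, by omega⟩) ?_ ?_ ?_ ?_ ?_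
  · intro k hk
    rw [Finset.mem_filter] at hk
    rw [Finset.mem_Icc]
    omega
  · intro x hx
    rw [Finset.mem_Icc] at hx
    rw [Finset.mem_filter, dif_pos (by omega)]
    refine ⟨Finset.mem_univ _, ?_⟩
    dsimp only
    omega
  · intro k hk
    rw [Finset.mem_filter] at hk
    rw [dif_pos (by omega)]
    ext
    dsimp only
    omega
  · intro x hx
    rw [Finset.mem_Icc] at hx
    rw [dif_pos (by omega)]
    dsimp only
    omega
  · intro k hk
    rw [Finset.mem_filter] at hk
    rw [dif_pos (by omega)]
    congr 1
    ext
    dsimp only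
    omega

/-- **Window plus tail.** `|Σ_k f k| ≤ |Σ_{window} f| + Σ_{tail} |f|`. [folklore] -/
theorem abs_sum_le_abs_window_add_tail {N : ℕ} (w : Fin N → Prop) [DecidablePred w] (f : Fin N → ℝ) :
    |∑ k : Fin N, f k| ≤ |∑ k : Fin N, if w k then f k else 0| + ∑ k : Fin N, if w k then 0 else |f k| := by
  have hsplit : ∑ k : Fin N, f k =
      (∑ k : Fin N, if w k then f k else 0) + ∑ k : Fin N, if w k then 0 else f k := by
    rw [← Finset.sum_add_distrib]
    refine Finset.sum_congr rfl fun k _ => ?_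
    split_ifs <;> simp
  have htail : |∑ k : Fin N, if w k then 0 else f k| ≤ ∑ k : Fin N, if w k then 0 else |f k| := by
    refine (Finset.abs_sum_le_sum_abs _ _).trans (le_of_eq (Finset.sum_congr rfl fun k _ => ?_))
    split_ifs <;> simp
  rw [hsplit]
  exact (abs_add_le _ _).trans (by linarith)

/-- **Tails shrink as the window grows.** [folklore] -/
theorem tail_antitone {N R R' : ℕ} (hR : R ≤ R') (f : Fin N → ℝ) :
    (∑ k : Fin N, if (N - 1) / 2 ≤ k.val + R' ∧ k.val ≤ (N - 1) / 2 + R' then 0 else |f k|) ≤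
      ∑ k : Fin N, if (N - 1) / 2 ≤ k.val + R ∧ k.val ≤ (N - 1) / 2 + R then 0 else |f k| := by
  refine Finset.sum_le_sum fun k _ => ?_
  by_cases h : (N - 1) / 2 ≤ k.val + R ∧ k.val ≤ (N - 1) / 2 + R
  · rw [if_pos h, if_pos (by omega)]
  · rw [if_neg h]
    split_ifs
    · exact abs_nonneg _
    · exact le_rfl

/-- **The window has at most `2R + 1` bonds**: `Σ_{window} B ≤ (2R + 1) B` for `B ≥ 0`. [folklore] -/
theorem sum_ite_window_const_le {N R : ℕ} {B : ℝ} (hB : 0 ≤ B) :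
    (∑ k : Fin N, if (N - 1) / 2 ≤ k.val + R ∧ k.val ≤ (N - 1) / 2 + R then B else 0) ≤
      (2 * R + 1) * B := by
  classical
  rw [← Finset.sum_filter, Finset.sum_const, nsmul_eq_mul]
  refine mul_le_mul_of_nonneg_right ?_ hB
  have hcard : (Finset.univ.filter fun k : Fin N =>
      (N - 1) / 2 ≤ k.val + R ∧ k.val ≤ (N - 1) / 2 + R).card ≤ (Finset.range (2 * R + 1)).card := by
    refine Finset.card_le_card_of_injOn (fun k : Fin N => k.val + R - (N - 1) / 2) ?_ ?_
    · intro k hk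
      rw [Finset.mem_coe, Finset.mem_filter] at hk
      dsimp only
      rw [Finset.mem_coe, Finset.mem_range]
      omega
    · intro k hk k' hk' h
      rw [Finset.mem_coe, Finset.mem_filter] at hk hk'
      exact Fin.ext (by dsimp only at h; omega)
  rw [Finset.card_range] at hcard
  exact_mod_cast hcard

end Window

end Summit.AtomisticToContinuum.FouriersLaw.Theorems.AbelThermodynamicLimit.LoomisCompactHorizonWitness

end
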